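import Summits.CriticalPhenomena.SAWScalingLimit.Theorems.SAWTotalPositivityBoundaryTP2Defs
import Summits.CriticalPhenomena.SAWScalingLimit.Theorems.SAWTotalPositivityBoundaryTP2Kernel
import Summits.CriticalPhenomena.SAWScalingLimit.Theorems.SAWTotalPositivityBoundaryTP2Symmetry
import Summits.CriticalPhenomena.SAWScalingLimit.Theorems.SAWTotalPositivityBoundaryTP2LadderRung
import Summits.CriticalPhenomena.SAWScalingLimit.Theorems.SAWTotalPositivityBoundaryTP2LadderKernelsInterior
import Summits.CriticalPhenomena.SAWScalingLimit.Theorems.EdgeOfPositivity.Negative.EdgeOfPositivityRectDomain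
import HarnessLib

/-!
# Crux `BoundaryTP2` (stmt-CriticalPhenomena-7115), line `Sketch`: two bottom sites, a top site
beyond them and the top site above the second bottom on a ladder — crossing vs nested pairing

Tool stub `stub_ladder_bbtt9_nested` of the line's skeleton: on the ladder
`R_L = discreteDomainGraph (rectDomain L 1) 1` (sites `{0..L} × {0,1}`), for bottom sites
`(c₁,0), (c₂,0)` and the top sites `(d₁,1)`, `(c₂,1)` with `c₁ < c₂ < d₁ ≤ L` (cyclic boundary
order `(c₁,0), (c₂,0), (d₁,1), (c₂,1)`), and every fugacity `0 ≤ x ≤ 1/2`, the crossing pairing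
weighs at most the nested one:

  `Z((c₁,0),(d₁,1)) · Z((c₂,0),(c₂,1)) ≤ Z((c₁,0),(c₂,1)) · Z((c₂,0),(d₁,1))`,  `Z = pathKernel R_L x`.

Proof. Write `P = 1+x`, `M = 1-x`, `E_k = Σ_{d<k} x^{2d+3}`, `e₁ = E_{c₁}`, `e₂ = E_{c₂}`,
`f₂ = E_{L-c₂}`, `f₃ = E_{L-d₁}`, `a₁ = P + e₁`, `a'₁ = M - e₁`, `a₂ = P + e₂`, `a'₂ = M - e₂`,
`b₂ = P + f₂`, `b'₂ = M - f₂`, `b₃ = P + f₃`, `b'₃ = M - f₃`, spans `d = c₂ - c₁ = u+1`,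
`n = d₁ - c₂ = m+1`. By the landed two-point kernels (`stub_ladderKernels_interior`,
`stub_ladderRung`) the three column-separated kernels have the rank-two form
(`bbtt9n_kernel_mixed`)

  `X = Z((c₁,0),(c₂,1)) = x^d/2 (a₁ b₂ P^{d-1} - a'₁ b'₂ M^{d-1})`,
  `Y = Z((c₂,0),(d₁,1)) = x^n/2 (a₂ b₃ P^{n-1} - a'₂ b'₃ M^{n-1})`,
  `W = Z((c₁,0),(d₁,1)) = x^{d+n}/2 (a₁ b₃ P^{d+n-1} - a'₁ b'₃ M^{d+n-1})`,

and the rung is `R = Z((c₂,0),(c₂,1)) = x + e₂ + f₂ = ½(a₂b₂/P - a'₂b'₂/M) + x e₂ f₂/(PM)`: its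
rank-two value plus the excess `δ = x e₂ f₂/(PM)`. Cauchy–Binet with inner dimension two gives the
exact residual identity (a `ring` identity in the free variables)

  `4PM (XY - WR) = x^{d+n} [a₁a'₂P^d - a'₁a₂M^d] [b₃b'₂P^n - b'₃b₂M^n] - 4x e₂ f₂ W`,

the product of the two ORIENTATION determinants against the rung excess. Each bracket is bounded
below consistently in its own variables: `[a₁a'₂P^d - a'₁a₂M^d] ≥ P^{d-1} h(e₁,e₂)` with
`h(e₁,e₂) = a₁a'₂P - a'₁a₂M = 2x(1-x²) + 2(1-x²)e₁ - (2+2x²)e₂ - 2x e₁e₂` (`M^d ≤ M P^{d-1}`), and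
the two-variable polynomial inequality `h(e₁,e₂) ≥ (5/4) e₂ a₁` on `0 ≤ x ≤ 1/2`, `e₁ ≥ 0`,
`0 ≤ e₂ ≤ x³/(1-x²)` (`bbtt9n_factor`: the `e₁`-coefficient `2(1-x²) - (2x + 5/4)e₂` is positive and
`(1-x²)(2x(1-x²) - e₂ C) ≥ x (2 - 29x²/4 - 5x³/4) ≥ 0`, `C = 2 + 2x² + 5(1+x)/4`). The same bounds
hold for the right bracket in `(f₃, f₂)`. Multiplying, `[…][…] ≥ (25/16) P^{d+n-2} e₂f₂ a₁b₃ ≥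
2xP · P^{d+n-2} e₂ f₂ a₁ b₃ ≥ 2x e₂ f₂ (a₁b₃P^{d+n-1} - a'₁b'₃M^{d+n-1})`, which is `4x e₂ f₂ W / x^{d+n}`
(`25/16 ≥ 3/2 ≥ 2x(1+x)`). Hence `WR ≤ XY` in `ℝ`, transferred to `ℝ≥0∞` by `ENNReal.ofReal_mul`,
`ENNReal.ofReal_le_ofReal`.
-/

noncomputable section

namespace Summit.CriticalPhenomena.SAWScalingLimit.Theorems.BoundaryTP2

open Literature.Probability.LatticeModels Literature.Probability.RandomPlanarGeometry
open Summit.CriticalPhenomena.SAWScalingLimit.Theorems.EdgeOfPositivity.Negative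
open scoped ENNReal

/-! ## The excursion sums `E_k = Σ_{d<k} x^{2d+3}` -/

-- adapted from `…BoundaryTP2LadderMinorCB` (`ladderCB_excursion_*`, `ladderCB_coef_nonneg`)

/-- `E_k ≥ 0` for `x ≥ 0`. [folklore] -/
private theorem bbtt9n_E_nonneg {x : ℝ} (hx : 0 ≤ x) (k : ℕ) :
    0 ≤ ∑ d ∈ Finset.range k, x ^ (2 * d + 3) :=
  Finset.sum_nonneg fun _ _ => pow_nonneg hx _

/-- Geometric identity `E_k (1 - x²) = x³ - x^{2k+3}`. [folklore] -/
private theorem bbtt9n_E_mul (x : ℝ) (k : ℕ) :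
    (∑ d ∈ Finset.range k, x ^ (2 * d + 3)) * (1 - x ^ 2) = x ^ 3 - x ^ (2 * k + 3) := by
  induction k with
  | zero => simp
  | succ k ih =>
    rw [Finset.sum_range_succ, add_mul, ih]
    ring

/-- Geometric bound `E_k (1 - x²) ≤ x³` for `x ≥ 0`. [folklore] -/
private theorem bbtt9n_E_bound {x : ℝ} (hx : 0 ≤ x) (k : ℕ) :
    (∑ d ∈ Finset.range k, x ^ (2 * d + 3)) * (1 - x ^ 2) ≤ x ^ 3 := by
  rw [bbtt9n_E_mul]
  linarith [pow_nonneg hx (2 * k + 3)]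

/-- For `0 ≤ x ≤ 1/2`, `0 ≤ E` and `E (1-x²) ≤ x³` one has `E ≤ 1/6` (`E · 3/4 ≤ x³ ≤ 1/8`).
[folklore] -/
private theorem bbtt9n_le_sixth {x E : ℝ} (hx0 : 0 ≤ x) (hx : x ≤ 1 / 2) (hE : 0 ≤ E)
    (hEb : E * (1 - x ^ 2) ≤ x ^ 3) : E ≤ 1 / 6 := by
  have hx2 : x ^ 2 ≤ (1 / 2) ^ 2 := pow_le_pow_left₀ hx0 hx 2
  have hx3 : x ^ 3 ≤ (1 / 2) ^ 3 := pow_le_pow_left₀ hx0 hx 3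
  norm_num at hx2 hx3
  have h1 : E * (3 / 4) ≤ E * (1 - x ^ 2) := mul_le_mul_of_nonneg_left (by linarith) hE
  linarith

/-! ## The orientation function and the one-pair factor inequality -/

/-- **The one-pair factor inequality.** For `0 ≤ x ≤ 1/2`, `E₁ ≥ 0` and `0 ≤ E₂` with
`E₂ (1-x²) ≤ x³`: `(5/4) E₂ (1+x+E₁) ≤ h(E₁,E₂) := (1+x+E₁)(1-x-E₂)(1+x) - (1-x-E₁)(1+x+E₂)(1-x)`.
Indeed `h - (5/4)E₂(1+x+E₁) = [2x(1-x²) - E₂ C] + E₁ [2(1-x²) - (2x + 5/4) E₂]` with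
`C = 2 + 2x² + (5/4)(1+x)`; the `E₁`-coefficient is `≥ 3/2 - 3/8 > 0` (`E₂ ≤ 1/6`), and
`(1-x²)(2x(1-x²) - E₂ C) = x (2 - (29/4)x² - (5/4)x³) + C (x³ - E₂(1-x²)) ≥ 0`. [folklore] -/
private theorem bbtt9n_factor {x E₁ E₂ : ℝ} (hx0 : 0 ≤ x) (hx : x ≤ 1 / 2) (hE₁ : 0 ≤ E₁)
    (hE₂ : 0 ≤ E₂) (hE₂b : E₂ * (1 - x ^ 2) ≤ x ^ 3) :
    5 / 4 * E₂ * (1 + x + E₁) ≤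
      (1 + x + E₁) * (1 - x - E₂) * (1 + x) - (1 - x - E₁) * (1 + x + E₂) * (1 - x) := by
  have hE₂' : E₂ ≤ 1 / 6 := bbtt9n_le_sixth hx0 hx hE₂ hE₂b
  have hx2 : x ^ 2 ≤ (1 / 2) ^ 2 := pow_le_pow_left₀ hx0 hx 2
  have hx3 : x ^ 3 ≤ (1 / 2) ^ 3 := pow_le_pow_left₀ hx0 hx 3
  norm_num at hx2 hx3
  -- the `E₁`-part
  have hxE : x * E₂ ≤ 1 / 2 * (1 / 6) := mul_le_mul hx hE₂' hE₂ (by norm_num)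
  have t1 : 0 ≤ E₁ * (2 * (1 - x ^ 2) - (2 * x + 5 / 4) * E₂) := mul_nonneg hE₁ (by nlinarith)
  -- the constant part
  have hC : 0 ≤ 2 + 2 * x ^ 2 + 5 / 4 * (1 + x) := by positivity
  have h1x2 : 0 < 1 - x ^ 2 := by linarith
  have hf : 0 ≤ x * (2 - 29 / 4 * x ^ 2 - 5 / 4 * x ^ 3) := mul_nonneg hx0 (by nlinarith)
  have hEC : E₂ * (1 - x ^ 2) * (2 + 2 * x ^ 2 + 5 / 4 * (1 + x)) ≤
      x ^ 3 * (2 + 2 * x ^ 2 + 5 / 4 * (1 + x)) := mul_le_mul_of_nonneg_right hE₂b hC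
  have e2 : (1 - x ^ 2) * (2 * x * (1 - x ^ 2) - E₂ * (2 + 2 * x ^ 2 + 5 / 4 * (1 + x))) =
      x * (2 - 29 / 4 * x ^ 2 - 5 / 4 * x ^ 3) +
        (x ^ 3 * (2 + 2 * x ^ 2 + 5 / 4 * (1 + x)) -
          E₂ * (1 - x ^ 2) * (2 + 2 * x ^ 2 + 5 / 4 * (1 + x))) := by
    ring
  have t2' : 0 ≤ (1 - x ^ 2) * (2 * x * (1 - x ^ 2) - E₂ * (2 + 2 * x ^ 2 + 5 / 4 * (1 + x))) := by
    rw [e2]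
    linarith
  have t2 : 0 ≤ 2 * x * (1 - x ^ 2) - E₂ * (2 + 2 * x ^ 2 + 5 / 4 * (1 + x)) :=
    (mul_nonneg_iff_of_pos_left h1x2).mp t2'
  -- assembly
  have e : (1 + x + E₁) * (1 - x - E₂) * (1 + x) - (1 - x - E₁) * (1 + x + E₂) * (1 - x) -
      5 / 4 * E₂ * (1 + x + E₁) =
      (2 * x * (1 - x ^ 2) - E₂ * (2 + 2 * x ^ 2 + 5 / 4 * (1 + x))) +
        E₁ * (2 * (1 - x ^ 2) - (2 * x + 5 / 4) * E₂) := by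
    ring
  linarith

/-- **The orientation bracket through its first term.** For `0 ≤ x ≤ 1/2`, `1 - x - E₁ ≥ 0`,
`E₂ ≥ 0` and every `k`:
`(1+x)^k · h(E₁,E₂) ≤ (1+x+E₁)(1-x-E₂)(1+x)^{k+1} - (1-x-E₁)(1+x+E₂)(1-x)^{k+1}`, the difference
being `(1-x-E₁)(1+x+E₂)(1-x)((1+x)^k - (1-x)^k) ≥ 0`. [folklore] -/
private theorem bbtt9n_bracket_lower {x E₁ E₂ : ℝ} (hx0 : 0 ≤ x) (hx : x ≤ 1 / 2)
    (ha₁ : 0 ≤ 1 - x - E₁) (hE₂ : 0 ≤ E₂) (k : ℕ) :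
    (1 + x) ^ k * ((1 + x + E₁) * (1 - x - E₂) * (1 + x) - (1 - x - E₁) * (1 + x + E₂) * (1 - x)) ≤
      (1 + x + E₁) * (1 - x - E₂) * (1 + x) ^ (k + 1) -
        (1 - x - E₁) * (1 + x + E₂) * (1 - x) ^ (k + 1) := by
  have hMP : (1 - x) ^ k ≤ (1 + x) ^ k := pow_le_pow_left₀ (by linarith) (by linarith) k
  have h0 : 0 ≤ (1 - x - E₁) * (1 + x + E₂) * (1 - x) * ((1 + x) ^ k - (1 - x) ^ k) :=
    mul_nonneg (mul_nonneg (mul_nonneg ha₁ (by linarith)) (by linarith)) (sub_nonneg.2 hMP)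
  have e : (1 + x + E₁) * (1 - x - E₂) * (1 + x) ^ (k + 1) -
        (1 - x - E₁) * (1 + x + E₂) * (1 - x) ^ (k + 1) -
      (1 + x) ^ k * ((1 + x + E₁) * (1 - x - E₂) * (1 + x) -
        (1 - x - E₁) * (1 + x + E₂) * (1 - x)) =
      (1 - x - E₁) * (1 + x + E₂) * (1 - x) * ((1 + x) ^ k - (1 - x) ^ k) := by
    ring
  linarith

/-- **One side of the residual inequality.** For `0 ≤ x ≤ 1/2`, `E₁, E₂ ≥ 0` with
`E₁ (1-x²) ≤ x³`, `E₂ (1-x²) ≤ x³` and every `k`: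
`(1+x)^k · (5/4) E₂ (1+x+E₁) ≤ (1+x+E₁)(1-x-E₂)(1+x)^{k+1} - (1-x-E₁)(1+x+E₂)(1-x)^{k+1}`
(`bbtt9n_factor` and `bbtt9n_bracket_lower`). [folklore] -/
private theorem bbtt9n_side {x E₁ E₂ : ℝ} (hx0 : 0 ≤ x) (hx : x ≤ 1 / 2) (hE₁ : 0 ≤ E₁)
    (hE₂ : 0 ≤ E₂) (hE₁b : E₁ * (1 - x ^ 2) ≤ x ^ 3) (hE₂b : E₂ * (1 - x ^ 2) ≤ x ^ 3) (k : ℕ) :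
    (1 + x) ^ k * (5 / 4 * E₂ * (1 + x + E₁)) ≤
      (1 + x + E₁) * (1 - x - E₂) * (1 + x) ^ (k + 1) -
        (1 - x - E₁) * (1 + x + E₂) * (1 - x) ^ (k + 1) := by
  have hE₁' : E₁ ≤ 1 / 6 := bbtt9n_le_sixth hx0 hx hE₁ hE₁b
  exact (mul_le_mul_of_nonneg_left (bbtt9n_factor hx0 hx hE₁ hE₂ hE₂b)
    (pow_nonneg (by linarith) k)).trans (bbtt9n_bracket_lower hx0 hx (by linarith) hE₂ k)

/-! ## The mixed (opposite-row) bracket -/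

/-- A mixed bracket is nonnegative: `a' b' M^k ≤ a b P^k` termwise (`a' ≤ a`, `0 ≤ b' ≤ b`,
`0 ≤ M ≤ P`; `e ≥ 0`, `0 ≤ f ≤ 1/6`). [folklore] -/
private theorem bbtt9n_diff_nonneg {x e f : ℝ} (k : ℕ) (hx0 : 0 ≤ x) (hx : x ≤ 1 / 2)
    (he0 : 0 ≤ e) (hf0 : 0 ≤ f) (hf : f ≤ 1 / 6) :
    0 ≤ (1 + x + e) * (1 + x + f) * (1 + x) ^ k - (1 - x - e) * (1 - x - f) * (1 - x) ^ k :=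
  -- adapted from `ladderBbbt_diff_nonneg` in `…BoundaryTP2LadderBbbtAdjacent`
  sub_nonneg.2
    (mul_le_mul (mul_le_mul (by linarith) (by linarith) (by linarith) (by linarith))
      (pow_le_pow_left₀ (by linarith) (by linarith) k) (pow_nonneg (by linarith) k)
      (mul_nonneg (by linarith) (by linarith)))

/-- The rank-two form of a mixed kernel is nonnegative. [folklore] -/
private theorem bbtt9n_form_nonneg {x e f : ℝ} (k : ℕ) (hx0 : 0 ≤ x) (hx : x ≤ 1 / 2)
    (he0 : 0 ≤ e) (hf0 : 0 ≤ f) (hfb : f * (1 - x ^ 2) ≤ x ^ 3) :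
    0 ≤ x ^ (k + 1) / 2 *
      ((1 + x + e) * (1 + x + f) * (1 + x) ^ k - (1 - x - e) * (1 - x - f) * (1 - x) ^ k) :=
  mul_nonneg (by positivity) (bbtt9n_diff_nonneg k hx0 hx he0 hf0 (bbtt9n_le_sixth hx0 hx hf0 hfb))

/-! ## The real inequality -/

/-- **The real inequality behind the stub**, in the rank-two variables `e₁ = E_{c₁}`, `e₂ = E_{c₂}`,
`f₂ = E_{L-c₂}`, `f₃ = E_{L-d₁}`, spans `c₂ - c₁ = u+1`, `d₁ - c₂ = m+1`: `W · R ≤ X · Y` where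
`W, X, Y` are the mixed real forms and `R = x + e₂ + f₂` the rung. Mechanism: the `ring` identity
`4PM(XY - WR) = x^{u+m+2}(br_E br_F - (25/16) P^u P^m e₂f₂a₁b₃) + x^{u+m+2} P^u P^m e₂f₂a₁b₃ (25/16 - 2x(1+x))
 + 2x·x^{u+m+2} e₂ f₂ a'₁ b'₃ M^{u+m+1}` with three nonnegative terms (`bbtt9n_side` twice).
[folklore] -/
private theorem bbtt9n_real {x e₁ e₂ f₂ f₃ : ℝ} (u m : ℕ) (hx0 : 0 ≤ x) (hx : x ≤ 1 / 2)
    (he₁ : 0 ≤ e₁) (he₁b : e₁ * (1 - x ^ 2) ≤ x ^ 3) (he₂ : 0 ≤ e₂)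
    (he₂b : e₂ * (1 - x ^ 2) ≤ x ^ 3) (hf₂ : 0 ≤ f₂) (hf₂b : f₂ * (1 - x ^ 2) ≤ x ^ 3)
    (hf₃ : 0 ≤ f₃) (hf₃b : f₃ * (1 - x ^ 2) ≤ x ^ 3) :
    x ^ (u + m + 1 + 1) / 2 *
          ((1 + x + e₁) * (1 + x + f₃) * (1 + x) ^ (u + m + 1) -
            (1 - x - e₁) * (1 - x - f₃) * (1 - x) ^ (u + m + 1)) *
        (x + e₂ + f₂) ≤
      x ^ (u + 1) / 2 *
          ((1 + x + e₁) * (1 + x + f₂) * (1 + x) ^ u -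
            (1 - x - e₁) * (1 - x - f₂) * (1 - x) ^ u) *
        (x ^ (m + 1) / 2 *
          ((1 + x + e₂) * (1 + x + f₃) * (1 + x) ^ m -
            (1 - x - e₂) * (1 - x - f₃) * (1 - x) ^ m)) := by
  have he₁' : e₁ ≤ 1 / 6 := bbtt9n_le_sixth hx0 hx he₁ he₁b
  have hf₃' : f₃ ≤ 1 / 6 := bbtt9n_le_sixth hx0 hx hf₃ hf₃b
  have hP : 0 ≤ 1 + x := by linarith
  have hsc : 0 ≤ 25 / 16 - 2 * x * (1 + x) := by
    nlinarith [mul_le_mul hx hx hx0 (by norm_num : (0 : ℝ) ≤ 1 / 2)]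
  -- the two orientation brackets, bounded below consistently in their own variables
  have hE := bbtt9n_side hx0 hx he₁ he₂ he₁b he₂b u
  have hF := bbtt9n_side hx0 hx hf₃ hf₂ hf₃b hf₂b m
  have hE0 : 0 ≤ (1 + x) ^ u * (5 / 4 * e₂ * (1 + x + e₁)) := by positivity
  have hF0 : 0 ≤ (1 + x) ^ m * (5 / 4 * f₂ * (1 + x + f₃)) := by positivity
  have prod := mul_le_mul hE hF hF0 (hE0.trans hE)
  -- the three nonnegative terms
  have t1 : 0 ≤ x ^ (u + m + 2) *
      (((1 + x + e₁) * (1 - x - e₂) * (1 + x) ^ (u + 1) -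
            (1 - x - e₁) * (1 + x + e₂) * (1 - x) ^ (u + 1)) *
          ((1 + x + f₃) * (1 - x - f₂) * (1 + x) ^ (m + 1) -
            (1 - x - f₃) * (1 + x + f₂) * (1 - x) ^ (m + 1)) -
        (1 + x) ^ u * (5 / 4 * e₂ * (1 + x + e₁)) * ((1 + x) ^ m * (5 / 4 * f₂ * (1 + x + f₃)))) :=
    mul_nonneg (pow_nonneg hx0 _) (sub_nonneg.2 prod)
  have t2 : 0 ≤ x ^ (u + m + 2) * ((1 + x) ^ u * (1 + x) ^ m * (e₂ * f₂ * ((1 + x + e₁) * (1 + x + f₃)))) *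
      (25 / 16 - 2 * x * (1 + x)) := by positivity
  have t3 : 0 ≤ 2 * x * x ^ (u + m + 2) * (e₂ * f₂) *
      ((1 - x - e₁) * (1 - x - f₃) * (1 - x) ^ (u + m + 1)) :=
    mul_nonneg (by positivity)
      (mul_nonneg (mul_nonneg (by linarith) (by linarith)) (pow_nonneg (by linarith) _))
  -- the residual identity (Cauchy–Binet with inner dimension two plus the rung excess)
  have key : 4 * (1 + x) * (1 - x) *
      (x ^ (u + 1) / 2 *
            ((1 + x + e₁) * (1 + x + f₂) * (1 + x) ^ u -
              (1 - x - e₁) * (1 - x - f₂) * (1 - x) ^ u) *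
          (x ^ (m + 1) / 2 *
            ((1 + x + e₂) * (1 + x + f₃) * (1 + x) ^ m -
              (1 - x - e₂) * (1 - x - f₃) * (1 - x) ^ m)) -
        x ^ (u + m + 1 + 1) / 2 *
            ((1 + x + e₁) * (1 + x + f₃) * (1 + x) ^ (u + m + 1) -
              (1 - x - e₁) * (1 - x - f₃) * (1 - x) ^ (u + m + 1)) *
          (x + e₂ + f₂)) =
      x ^ (u + m + 2) *
          (((1 + x + e₁) * (1 - x - e₂) * (1 + x) ^ (u + 1) -
                (1 - x - e₁) * (1 + x + e₂) * (1 - x) ^ (u + 1)) *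
              ((1 + x + f₃) * (1 - x - f₂) * (1 + x) ^ (m + 1) -
                (1 - x - f₃) * (1 + x + f₂) * (1 - x) ^ (m + 1)) -
            (1 + x) ^ u * (5 / 4 * e₂ * (1 + x + e₁)) *
              ((1 + x) ^ m * (5 / 4 * f₂ * (1 + x + f₃)))) +
        x ^ (u + m + 2) * ((1 + x) ^ u * (1 + x) ^ m * (e₂ * f₂ * ((1 + x + e₁) * (1 + x + f₃)))) *
          (25 / 16 - 2 * x * (1 + x)) +
        2 * x * x ^ (u + m + 2) * (e₂ * f₂) *
          ((1 - x - e₁) * (1 - x - f₃) * (1 - x) ^ (u + m + 1)) := by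
    ring
  have h4 : 0 < 4 * (1 + x) * (1 - x) := mul_pos (mul_pos (by norm_num) (by linarith)) (by linarith)
  have hdiff : 0 ≤ x ^ (u + 1) / 2 *
            ((1 + x + e₁) * (1 + x + f₂) * (1 + x) ^ u -
              (1 - x - e₁) * (1 - x - f₂) * (1 - x) ^ u) *
          (x ^ (m + 1) / 2 *
            ((1 + x + e₂) * (1 + x + f₃) * (1 + x) ^ m -
              (1 - x - e₂) * (1 - x - f₃) * (1 - x) ^ m)) -
        x ^ (u + m + 1 + 1) / 2 *
            ((1 + x + e₁) * (1 + x + f₃) * (1 + x) ^ (u + m + 1) -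
              (1 - x - e₁) * (1 - x - f₃) * (1 - x) ^ (u + m + 1)) *
          (x + e₂ + f₂) := by
    refine (mul_nonneg_iff_of_pos_left h4).mp ?_
    rw [key]
    exact add_nonneg (add_nonneg t1 t2) t3
  exact sub_nonneg.mp hdiff

/-! ## The ladder kernels in rank-two form -/

/-- Bottom-to-top kernels of the ladder `{0..L}×{0,1}` in rank-two form: for `i + n + 1 = j ≤ L`
and `x ≥ 0`, `Z_{R_L}((i,0),(j,1)) = x^{n+1}/2 · (a_i b_j (1+x)^n - a'_i b'_j (1-x)^n)` with
`a_i = 1+x+E_i`, `a'_i = 1-x-E_i`, `b_j = 1+x+E_{L-j}`, `b'_j = 1-x-E_{L-j}` (the sign `ε = -1` of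
`stub_ladderKernels_interior` for endpoints on different rows). [folklore] -/
private theorem bbtt9n_kernel_mixed (L i j n : ℕ) (hn : i + n + 1 = j) (hjL : j ≤ L) {x : ℝ}
    (hx : 0 ≤ x) :
    pathKernel (discreteDomainGraph (rectDomain L 1) 1) x (st i 0) (st j 1) =
      ENNReal.ofReal (x ^ (n + 1) / 2 *
        ((1 + x + ∑ d ∈ Finset.range i, x ^ (2 * d + 3)) *
              (1 + x + ∑ d ∈ Finset.range (L - j), x ^ (2 * d + 3)) * (1 + x) ^ n -
          (1 - x - ∑ d ∈ Finset.range i, x ^ (2 * d + 3)) *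
              (1 - x - ∑ d ∈ Finset.range (L - j), x ^ (2 * d + 3)) * (1 - x) ^ n)) := by
  -- adapted from `ladderBbbt_kernel_mixed` in `…BoundaryTP2LadderBbbtAdjacent`
  rw [stub_ladderKernels_interior L i j (by omega) hjL hx 0 1 (Or.inl rfl) (Or.inr rfl),
    if_neg (by norm_num : (0 : ℤ) ≠ 1)]
  congr 1
  subst hn
  have e1 : i + n + 1 - i = n + 1 := by omega
  have e2 : n + 1 - 1 = n := rfl
  rw [e1, e2]
  ring

/-! ## The stub -/

/-- **Tool stub `stub_ladder_bbtt9_nested`.** On the ladder `{0..L}×{0,1}`, for bottom sites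
`(c₁,0), (c₂,0)` and top sites `(d₁,1)`, `(c₂,1)` with `c₁ < c₂ < d₁ ≤ L` (cyclic order
`(c₁,0),(c₂,0),(d₁,1),(c₂,1)`) and `0 ≤ x ≤ 1/2`, the crossing pairing weighs at most the NESTED
one: `Z((c₁,0),(d₁,1)) · Rung(c₂) ≤ Z((c₁,0),(c₂,1)) · Z((c₂,0),(d₁,1))`. Mechanism: the exact
residual identity `4PM(XY - WR) = x^{d+n}[a₁a'₂P^d - a'₁a₂M^d][b₃b'₂P^n - b'₃b₂M^n] - 4x E_{c₂}E_{L-c₂} W`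
(product of both orientation determinants against the rung excess `x E_{c₂} E_{L-c₂}/(PM)`), each
bracket bounded below in its own variables by `P^{k-1} · (5/4) E a` (`bbtt9n_side`), and
`25/16 ≥ 2x(1+x)`. [folklore] -/
theorem stub_ladder_bbtt9_nested (L : ℕ) {c₁ c₂ d₁ : ℕ} (h₁ : c₁ < c₂) (h₂ : c₂ < d₁) (h₃ : d₁ ≤ L)
    {x : ℝ} (hx0 : 0 ≤ x) (hx : x ≤ 1 / 2) :
    pathKernel (discreteDomainGraph (rectDomain L 1) 1) x (st c₁ 0) (st d₁ 1) *
        pathKernel (discreteDomainGraph (rectDomain L 1) 1) x (st c₂ 0) (st c₂ 1) ≤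
      pathKernel (discreteDomainGraph (rectDomain L 1) 1) x (st c₁ 0) (st c₂ 1) *
        pathKernel (discreteDomainGraph (rectDomain L 1) 1) x (st c₂ 0) (st d₁ 1) := by
  obtain ⟨u, hu⟩ : ∃ u, c₁ + u + 1 = c₂ := ⟨c₂ - c₁ - 1, by omega⟩
  obtain ⟨m, hm⟩ : ∃ m, c₂ + m + 1 = d₁ := ⟨d₁ - c₂ - 1, by omega⟩
  have hE : ∀ k : ℕ, 0 ≤ ∑ d ∈ Finset.range k, x ^ (2 * d + 3) := bbtt9n_E_nonneg hx0
  have hEb : ∀ k : ℕ, (∑ d ∈ Finset.range k, x ^ (2 * d + 3)) * (1 - x ^ 2) ≤ x ^ 3 :=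
    bbtt9n_E_bound hx0
  rw [bbtt9n_kernel_mixed L c₁ d₁ (u + m + 1) (by omega) h₃ hx0, stub_ladderRung L c₂ (by omega) hx0,
    bbtt9n_kernel_mixed L c₁ c₂ u hu (by omega) hx0, bbtt9n_kernel_mixed L c₂ d₁ m hm h₃ hx0,
    ← ENNReal.ofReal_mul
      (bbtt9n_form_nonneg (u + m + 1) hx0 hx (hE c₁) (hE (L - d₁)) (hEb (L - d₁))),
    ← ENNReal.ofReal_mul (bbtt9n_form_nonneg u hx0 hx (hE c₁) (hE (L - c₂)) (hEb (L - c₂)))]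
  exact ENNReal.ofReal_le_ofReal (bbtt9n_real u m hx0 hx (hE c₁) (hEb c₁) (hE c₂) (hEb c₂)
    (hE (L - c₂)) (hEb (L - c₂)) (hE (L - d₁)) (hEb (L - d₁)))

end Summit.CriticalPhenomena.SAWScalingLimit.Theorems.BoundaryTP2
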